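import Summits.BirchSwinnertonDyer.BirchSwinnertonDyer.Theorems.ByReductionTypeAtTwoSupersingularFlatBlindTamagawaKernel
import Summits.BirchSwinnertonDyer.BirchSwinnertonDyer.Theorems.ByReductionTypeAtTwoSupersingularFlatBlindTamagawaLevel
import Summits.BirchSwinnertonDyer.BirchSwinnertonDyer.Theorems.ByReductionTypeAtTwoSupersingularFlatBlindTamagawaLocal
import Summits.BirchSwinnertonDyer.BirchSwinnertonDyer.Theorems.ByReductionTypeAtTwoSupersingularFlatBlindTamagawaDual
import Summits.BirchSwinnertonDyer.Rank1Residual.Additive.AdicIntegersQuotientPrimePowCard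
import Summits.BirchSwinnertonDyer.Rank1Residual.X11b.LocalPrimaryCohomologyEP
import Summits.BirchSwinnertonDyer.Rank1Residual.X11b.KummerPoitouTateExact
import Literature.NumberTheory.GaloisCohomology.PoitouTateSelmerCountProofs
import HarnessLib

/-!
# HT-C6 (B2 Tamagawa splitting), file 4/5: THE W₂-SIDE TAMAGAWA SPLITTING COUNT (no twist, no dictionary) — Kummer at `∞`, a line
# `L` at `v ∣ 2`, Greenberg's tower kernels at `ℓ ≠ v` (crux `SupersingularRankZeroAtTwo` = stmt-BirchSwinnertonDyer-19097, line
# `odd_blind_package` v2.10.1, slot 5 CDC_H, glue ★★ p814705 binder hB2; cell `bsd-2adic`, seat `bsd-2adic-t42` GEN 41)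

THEOREM ONLY (no definition, no named fact, no instance, no `sorry`); `--supports stmt-BirchSwinnertonDyer-19097 --as helper`; route-free
imports; closes nothing; typed ≠ proved; BSD is proved for no curve. CONDITIONAL on the print binder
`hPT : poitouTate_selmerStructure_duality_real ℚ` (Milne ADT I Thm. 4.10 + Ex. 1.6 (c), director-bsd (764)(A)(i)).

★ `natCard_selmerGroup_mul_eq_of_line`. DATA: `W₂/ℚ` elliptic, `κ` the cyclotomic `ℤ₂`-extension, `v ∋ 2` with `W₂(ℚ_v)[2] = 0`, a bound
`B`. CLAIM: there is `J₁` such that for every `J ≥ J₁`, every subgroup `L ≤ H¹(ℚ_v, W₂[2^J])` with `2^J ≤ #L`, and every pair of Selmer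
structures `𝓑' ≤ 𝓑` on `W₂[2^J]` with `𝓑 = 𝓑' =` Kummer at `∞`, `𝓑 = 𝓑' = L` at `v`, `𝓑' =` Kummer and
`𝓑 = 𝓚_J(ℓ) := H¹(i)⁻¹(ker(H¹(ℚ_ℓ, W₂) → H¹((ℚ_∞)_w, W₂)))` at `ℓ ≠ v`, and `#H¹_𝓑 ≤ B`:
**`#H¹_𝓑 · 2^{v₂ c_v(W₂)} = #H¹_{𝓑'} · 2^{v₂ Tam(W₂)}`.**
PROOF. (a) Poitou–Tate in counting form (tree `natCard_selmerQuotient_mul_of_poitouTate`, Milne I 4.10 / Howard 2.1.11) for `𝓑' ≤ 𝓑`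
on the exceptional set `Tx ⊇ ∞ ∪ {v} ∪ {bad}` of `W₂` (`KummerPT.exists_exceptional_finset`; both structures unramified outside `Tx`:
at a good `ℓ ∉ Tx` the tower kernel is trivial, `c_ℓ = 1`): `[H¹_𝓑 : H¹_{𝓑'}] · [H¹_{𝓑'^*} : H¹_{𝓑^*}] = ∏_{ℓ∈S_f} [𝓚_J(ℓ) : Kum_J(ℓ)]`.
(b) Local factors: `[𝓚_J(ℓ) : Kum_J(ℓ)] = #ker(res_tower) = 2^{v₂ c_ℓ(W₂)}` for `J ≥ v₂ c_ℓ` (Kummer sequence, file 2/5, and HT-C3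
`FlatBlindTamagawaKernel.…_of_isCyclotomic`, tower-1 ★★ p814192); `2^{v₂ Tam} = ∏_{S_f} 2^{v₂ c_ℓ}` (file 2/5).
(c) THE DUAL CORRECTION IS TRIVIAL for `J ≥ B + max e_ℓ`: by Sakamoto's Weil transport `H¹_{𝓐^*} = H¹(w)(H¹_{w⁻¹𝓐^*})`
(`X5.SelfDualCount`) it suffices that `H¹_{w⁻¹𝓑'^*} ≤ H¹_{w⁻¹𝓑^*}`; the two transported structures differ only at `ℓ ∈ S_f ∖ {v}`,
where `w⁻¹𝓑'^*_ℓ = Kum_ℓ` (Kummer self-duality at every place incl. the REAL one, `X5.SelfDualCount.dualTransported_kummerSelmerStructure_eq`,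
Tate local duality + `hPT`'s `InjectiveAtRealPlaces`); `H¹_{w⁻¹𝓑'^*}` is finite of order `≤ #H¹_{𝓑'} ≤ B` (file 3/5
`natCard_selmerGroup_dualTransported_update_le`: one-place count + `[Kum^{v↦⊤} : Kum^{v↦⊥}] = 2^J` (`X5.…relIndex_kummer_update_bot_update_top_eq`,
`W₂(ℚ_v)[2] = 0`) + `#H¹(ℚ_v, W₂[2^J]) = 4^J` (Tate, `…eq_sqEP`) + THE LINE BOUND `2^J ≤ #L`), so its classes are killed by `2^B`, and
a class killed by `2^B` with Kummer localisation at `ℓ` has ZERO localisation there once `J ≥ B + e_ℓ` (file 1/5: level lowering through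
`W₂[2^∞]` — no `Γ_ℚ`-fixed point since `W₂(ℚ_v)[2] = 0` — and HT-C4(c) ★ p814002).

References: [GreenbergLNM1716] §3 Lemma 3.3, §4 pp. 122–124; [MilneADT2006] I Cor. 2.3, Thm. 2.8, Thm. 2.13, Lemma 3.3, Thm. 4.10;
[Howard2004HeegnerKolyvagin] Thm. 2.1.11; [Sakamoto2024] §3.1.2; [SilvermanAEC2009] X.§4, VII.6.
-/

set_option autoImplicit false
set_option linter.dupNamespace false

noncomputable section

open scoped Classical NumberField AddSubgroup ContRepresentation

namespace Summit.BirchSwinnertonDyer.BirchSwinnertonDyer.Theorems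

namespace FlatBlindTamagawaSplitting

open NumberField IsDedekindDomain Field Function WeierstrassCurve Literature.NumberTheory.EllipticCurves
  Literature.NumberTheory.GaloisRepresentations Literature.NumberTheory.GaloisCohomology
open Literature.NumberTheory.GaloisRepresentations.DiscreteGaloisModule (SelmerStructure)
open Summit.BirchSwinnertonDyer.Rank1Residual.X11b Summit.BirchSwinnertonDyer.Rank1Residual.X11b.KummerPT
  Summit.BirchSwinnertonDyer.Rank1Residual.X11b.LocBridge Summit.BirchSwinnertonDyer.Rank1Residual.X5

/-- **THE W₂-SIDE TAMAGAWA SPLITTING COUNT.** (core; see the hand below for the meaning of the hypotheses) -/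
theorem natCard_selmerGroup_mul_eq_of_line (hPT : poitouTate_selmerStructure_duality_real ℚ)
    (W₂ : WeierstrassCurve ℚ) [W₂.IsElliptic] {κ : ZpExtension ℚ 2} (hκ : κ.IsCyclotomic)
    (v : HeightOneSpectrum (𝓞 ℚ)) (hv : (2 : 𝓞 ℚ) ∈ v.asIdeal)
    (h0v : ∀ Q : (W₂.baseChange (v.adicCompletion ℚ)).toAffine.Point, 2 • Q = 0 → Q = 0) (B : ℕ) :
    ∃ J₁ : ℕ, ∀ J : ℕ, J₁ ≤ J →
      ∀ (L : AddSubgroup (galoisCohomology ((W₂.torsionGaloisModule ((2 ^ J : ℕ) : ℤ)).toLocal (Sum.inr v)) 1)),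
        2 ^ J ≤ Nat.card L →
      ∀ (𝓑 𝓑' : SelmerStructure (W₂.torsionGaloisModule ((2 ^ J : ℕ) : ℤ))),
        (∀ w : InfinitePlace ℚ, 𝓑 (Sum.inl w) = W₂.kummerLocalConditionAt ((2 ^ J : ℕ) : ℤ) w.Completion) →
        𝓑 (Sum.inr v) = L →
        (∀ v' : HeightOneSpectrum (𝓞 ℚ), v' ≠ v → 𝓑 (Sum.inr v') =
          ((resH1Hom (Literature.NumberTheory.EllipticCurves.subgroupIncl (localSubgroup κ.kerSubgroup (v'.adicCompletion ℚ)))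
              (AddMonoidHom.id (localPoints W₂ (v'.adicCompletion ℚ))) (fun _ _ ↦ rfl)).ker).comap
            (galoisCohomology.map (W₂.torsionPointsMapIntertwining ((2 ^ J : ℕ) : ℤ) (v'.adicCompletion ℚ)) 1)) →
        (∀ w : InfinitePlace ℚ, 𝓑' (Sum.inl w) = W₂.kummerLocalConditionAt ((2 ^ J : ℕ) : ℤ) w.Completion) →
        𝓑' (Sum.inr v) = L →
        (∀ v' : HeightOneSpectrum (𝓞 ℚ), v' ≠ v → 𝓑' (Sum.inr v') = W₂.kummerLocalConditionAt ((2 ^ J : ℕ) : ℤ) (v'.adicCompletion ℚ)) →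
        Nat.card 𝓑.selmerGroup ≤ B →
        Nat.card 𝓑.selmerGroup *
            2 ^ padicValNat 2 ((W₂.baseChange (v.adicCompletion ℚ)).localTamagawaNumber (v.adicCompletionIntegers ℚ)) =
          Nat.card 𝓑'.selmerGroup * 2 ^ padicValNat 2 W₂.tamagawaProduct := by
  haveI h2 : Fact (Nat.Prime 2) := ⟨Nat.prime_two⟩
  -- the exceptional set `Tx ⊇ {v} ∪ ∞ ∪ {bad places of W₂}` (it contains the place above `2`, i.e. `v`)
  obtain ⟨Tx, hvTx, hinfTx, hpTx, hbadTx⟩ := exists_exceptional_finset W₂ 2 {(Sum.inr v : Place ℚ)}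
  have hvT : (Sum.inr v : Place ℚ) ∈ Tx := hvTx (Finset.mem_singleton_self _)
  set Sf : Finset (HeightOneSpectrum (𝓞 ℚ)) := Tx.preimage Sum.inr Sum.inr_injective.injOn with hSf
  have hSfmem : ∀ u, u ∈ Sf ↔ (Sum.inr u : Place ℚ) ∈ Tx := fun u ↦ by rw [hSf, Finset.mem_preimage]
  -- exponents killing `W₂(ℚ_ℓ)[2^∞]`, and the `2`-adic orders of the Tamagawa numbers
  choose e he using fun ℓ : HeightOneSpectrum (𝓞 ℚ) ↦ exists_pow_smul_eq_zero_of_isTorsion_adicCompletion W₂ 2 ℓ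
  set a : HeightOneSpectrum (𝓞 ℚ) → ℕ := fun ℓ ↦
    padicValNat 2 ((W₂.baseChange (ℓ.adicCompletion ℚ)).localTamagawaNumber (ℓ.adicCompletionIntegers ℚ)) with ha
  refine ⟨max 1 (max (B + Sf.sup e) (Sf.sup a)), fun J hJ L hL 𝓑 𝓑' h𝓑inl h𝓑v h𝓑ne h𝓑'inl h𝓑'v h𝓑'ne hB ↦ ?_⟩
  have hJ1 : 1 ≤ J := le_trans (le_max_left _ _) hJ
  have hJe : ∀ ℓ ∈ Sf, B + e ℓ ≤ J := fun ℓ hℓ ↦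
    le_trans (Nat.add_le_add_left (Finset.le_sup hℓ) B) (le_trans (le_max_left _ _) (le_trans (le_max_right _ _) hJ))
  have hJa : ∀ ℓ ∈ Sf, a ℓ ≤ J := fun ℓ hℓ ↦
    le_trans (Finset.le_sup hℓ) (le_trans (le_max_right _ _) (le_trans (le_max_right _ _) hJ))
  /- (0) instances, the Poitou–Tate family at level `2^J`, a Weil pairing on `W₂[2^J]` -/
  haveI : NeZero (2 ^ J) := ⟨pow_ne_zero J two_ne_zero⟩
  haveI : Finite (W₂.geomTorsion ((2 ^ J : ℕ) : ℤ)) := finite_geomTorsion_of_neZero W₂ (2 ^ J)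
  haveI : CompactSpace (absoluteGaloisGroup ℚ) := absoluteGaloisGroup_compactSpace ℚ
  have hnpp : IsPrimePow (2 ^ J) := Nat.prime_two.isPrimePow.pow (by omega)
  have hn2 : 2 ≤ 2 ^ J := by
    calc (2 : ℕ) = 2 ^ 1 := by norm_num
      _ ≤ 2 ^ J := Nat.pow_le_pow_right (by norm_num) hJ1
  have hv' : ((2 : ℕ) : 𝓞 ℚ) ∈ v.asIdeal := by exact_mod_cast hv
  have hMn : ∀ m : W₂.geomTorsion ((2 ^ J : ℕ) : ℤ), (2 ^ J) • m = 0 := fun m ↦ AddSubgroup.torsionBy.nsmul m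
  obtain ⟨inv, hperf, hvan, -, hcomp, hreal⟩ := hPT (2 ^ J)
  obtain ⟨e₂, hμ, hadd₁, hadd₂, halt, hnondeg, hgal⟩ := W₂.exists_weilPairing_holds (2 ^ J) hn2
    (Nat.cast_ne_zero.mpr (NeZero.ne (2 ^ J)))
  have hEP : ∀ u : HeightOneSpectrum (𝓞 ℚ), localEulerPoincareCharacteristic (u.adicCompletion ℚ) := fun u ↦
    localEulerPoincareCharacteristic_adicCompletionEP ℚ u
  -- the Kummer structure is residually self-dual at every place (finite: Tate + EP; real: `hreal`)
  have hKumT : ∀ u : Place ℚ, inv.dualTransported (W₂.kummerSelmerStructure ((2 ^ J : ℕ) : ℤ))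
      (weilDualIntertwining W₂ (2 ^ J) e₂ hμ hadd₁ hadd₂ hgal) u = W₂.kummerSelmerStructure ((2 ^ J : ℕ) : ℤ) u := fun u ↦
    SelfDualCount.dualTransported_kummerSelmerStructure_eq W₂ (2 ^ J) e₂ hμ hadd₁ hadd₂ hgal halt hnondeg inv hnpp hperf
      hEP hreal u
  /- (1) the two structures: `𝓑' = Kum^{v ↦ L}`, `𝓑 = 𝓑'` except at the finite `ℓ ≠ v`, where `𝓑 ℓ = 𝓚_J(ℓ) ≥ Kum ℓ` -/
  have h𝓑'eq : 𝓑' = Function.update (W₂.kummerSelmerStructure ((2 ^ J : ℕ) : ℤ)) (Sum.inr v) L := by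
    funext u
    rcases u with w | u
    · rw [Function.update_of_ne (by simp), h𝓑'inl w, WeierstrassCurve.kummerSelmerStructure_apply]; rfl
    · by_cases hu : u = v
      · rw [hu, Function.update_self, h𝓑'v]
      · rw [Function.update_of_ne (by simpa using hu), h𝓑'ne u hu, WeierstrassCurve.kummerSelmerStructure_apply]; rfl
  have hle : 𝓑' ≤ 𝓑 := by
    intro u
    rcases u with w | u
    · rw [h𝓑'inl w, h𝓑inl w]
    · by_cases hu : u = v
      · rw [hu, h𝓑'v, h𝓑v]
      · rw [h𝓑'ne u hu, h𝓑ne u hu]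
        exact kummerLocalConditionAt_le_comap W₂ _ _ _
  have hinfeq : ∀ w : InfinitePlace ℚ, 𝓑' (Sum.inl w) = 𝓑 (Sum.inl w) := fun w ↦ by rw [h𝓑'inl w, h𝓑inl w]
  /- (2) the tower kernels `K_ℓ`: order `2^{a ℓ}` at `ℓ ≠ v` (so killed by `2^J`), trivial at good `ℓ` -/
  have hK : ∀ ℓ : HeightOneSpectrum (𝓞 ℚ), ℓ ≠ v →
      Nat.card (resH1Hom (Literature.NumberTheory.EllipticCurves.subgroupIncl (localSubgroup κ.kerSubgroup (ℓ.adicCompletion ℚ)))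
        (AddMonoidHom.id (localPoints W₂ (ℓ.adicCompletion ℚ))) (fun _ _ ↦ rfl)).ker = 2 ^ a ℓ := by
    intro ℓ hℓ
    have hℓ2 : ((2 : ℕ) : 𝓞 ℚ) ∉ ℓ.asIdeal := fun h ↦ hℓ (eq_of_natCast_mem_asIdeal (p := 2) hv' h)
    exact FlatBlindTamagawaKernel.natCard_ker_resH1Hom_eq_pow_padicValNat_localTamagawaNumber_of_isCyclotomic W₂ hκ hℓ2
  have hnJ : ((2 ^ J : ℕ) : ℤ) ≠ 0 := by exact_mod_cast pow_ne_zero J two_ne_zero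
  -- the local count `#𝓑_ℓ = #𝓑'_ℓ · 2^{a ℓ}` at `ℓ ∈ Sf`, `ℓ ≠ v`
  have hloc𝓑 : ∀ ℓ ∈ Sf, ℓ ≠ v → Nat.card (𝓑 (Sum.inr ℓ)) = Nat.card (𝓑' (Sum.inr ℓ)) * 2 ^ a ℓ := by
    intro ℓ hℓS hℓ
    rw [h𝓑ne ℓ hℓ, h𝓑'ne ℓ hℓ, ← hK ℓ hℓ]
    exact natCard_comap_map_torsionPointsMap_eq W₂ ℓ hnJ _
      (forall_zsmul_eq_zero_of_natCard_eq_pow _ (hK ℓ hℓ) (hJa ℓ hℓS))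
  -- at a place outside `Tx` (good, `≠ v`): `K_ℓ = 0`, so `𝓑 = 𝓑'` there
  have heqoff : ∀ ℓ : HeightOneSpectrum (𝓞 ℚ), (Sum.inr ℓ : Place ℚ) ∉ Tx → 𝓑 (Sum.inr ℓ) = 𝓑' (Sum.inr ℓ) := by
    intro ℓ hℓT
    have hℓ : ℓ ≠ v := fun h ↦ hℓT (h ▸ hvT)
    have hgood : W₂.HasGoodReductionAt ℓ := by_contra fun h ↦ hℓT (hbadTx ℓ h)
    have h1 : Nat.card (resH1Hom (Literature.NumberTheory.EllipticCurves.subgroupIncl (localSubgroup κ.kerSubgroup (ℓ.adicCompletion ℚ)))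
        (AddMonoidHom.id (localPoints W₂ (ℓ.adicCompletion ℚ))) (fun _ _ ↦ rfl)).ker = 1 := by
      rw [hK ℓ hℓ, ha]
      simp only [W₂.localTamagawaNumber_eq_one_of_hasGoodReductionAt_holds ℓ hgood, padicValNat_one_right, pow_zero]
    rw [h𝓑ne ℓ hℓ, h𝓑'ne ℓ hℓ, AddSubgroup.eq_bot_of_card_eq _ h1]
    exact comap_map_torsionPointsMap_bot W₂ _ _
  /- (3) both structures are unramified outside `Tx` -/
  have hKumUnr : SelmerStructure.IsUnramifiedOutside (W₂.kummerSelmerStructure ((2 ^ J : ℕ) : ℤ)) Tx :=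
    KummerDuality.kummerSelmerStructure_isUnramifiedOutside W₂ 2 J Tx hinfTx hpTx hbadTx
  have h𝓑'unr : 𝓑'.IsUnramifiedOutside Tx := by
    rw [h𝓑'eq]; exact SelfDualCount.isUnramifiedOutside_update W₂ (2 ^ J) hKumUnr hvT L
  have h𝓑unr : 𝓑.IsUnramifiedOutside Tx :=
    ⟨h𝓑'unr.1, fun ℓ hℓ ↦ by rw [heqoff ℓ hℓ]; exact h𝓑'unr.2 ℓ hℓ⟩
  have hTout : ∀ ℓ : HeightOneSpectrum (𝓞 ℚ), (Sum.inr ℓ : Place ℚ) ∉ Tx →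
      (((2 ^ J : ℕ) : ℕ) : 𝓞 ℚ) ∉ ℓ.asIdeal ∧ GaloisRep.IsUnramifiedAt ℓ (W₂.torsionGaloisModule ((2 ^ J : ℕ) : ℤ)) := by
    intro ℓ hℓT
    have hpv : ((2 : ℕ) : 𝓞 ℚ) ∉ ℓ.asIdeal := fun h ↦ hℓT (hpTx ℓ h)
    have hgood : W₂.HasGoodReductionAt ℓ := by_contra fun h ↦ hℓT (hbadTx ℓ h)
    have hpkv : ((2 ^ J : ℕ) : 𝓞 ℚ) ∉ ℓ.asIdeal := by
      rw [Nat.cast_pow]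
      exact fun h ↦ hpv (ℓ.isPrime.mem_of_pow_mem J h)
    exact ⟨hpkv, AcSelmer.isUnramifiedAt_torsionGaloisModule W₂ hgood (by rw [Int.cast_natCast]; exact hpkv)⟩
  /- (4) Poitou–Tate, counting form (Milne I 4.10 / Howard 2.1.11) for `𝓑' ≤ 𝓑` on `Tx` -/
  have key := natCard_selmerQuotient_mul_of_poitouTate hperf hvan hcomp (W₂.torsionGaloisModule ((2 ^ J : ℕ) : ℤ)) hMn Tx
    hTout hle h𝓑'unr h𝓑unr hinfeq Sf hSfmem
  /- (5) THE DUAL CORRECTION IS TRIVIAL for `J ≥ J₁` -/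
  have hD : Nat.card ((inv.dualSelmerStructure (W₂.torsionGaloisModule ((2 ^ J : ℕ) : ℤ)) 𝓑').selmerGroup ⧸
      ((inv.dualSelmerStructure (W₂.torsionGaloisModule ((2 ^ J : ℕ) : ℤ)) 𝓑).selmerGroup).addSubgroupOf
        (inv.dualSelmerStructure (W₂.torsionGaloisModule ((2 ^ J : ℕ) : ℤ)) 𝓑').selmerGroup) = 1 := by
    -- (5a) the transported dual `w⁻¹𝓑'^*` has a FINITE Selmer group of order `≤ #H¹_{𝓑'} ≤ #H¹_𝓑 ≤ B`
    have hker1 : Nat.card (nsmulAddMonoidHom (2 ^ J) : (W₂.baseChange (v.adicCompletion ℚ)).toAffine.Point →+ _).ker = 1 := by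
      have hk : (nsmulAddMonoidHom (2 ^ J) : (W₂.baseChange (v.adicCompletion ℚ)).toAffine.Point →+ _).ker = ⊥ := by
        rw [eq_bot_iff]
        intro P hP
        rw [AddMonoidHom.mem_ker, nsmulAddMonoidHom_apply] at hP
        have : ∀ (k : ℕ) (Q : (W₂.baseChange (v.adicCompletion ℚ)).toAffine.Point), 2 ^ k • Q = 0 → Q = 0 := by
          intro k; induction k with
          | zero => intro Q hQ; simpa using hQ
          | succ k ih => intro Q hQ; rw [pow_succ, mul_smul] at hQ; exact h0v Q (ih (2 • Q) hQ)
        exact (AddSubgroup.mem_bot).2 (this J P hP)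
      rw [hk, AddSubgroup.card_bot]
    have hq : Nat.card (v.adicCompletionIntegers ℚ ⧸ Ideal.span {((2 ^ J : ℕ) : v.adicCompletionIntegers ℚ)}) = 2 ^ J :=
      Summit.BirchSwinnertonDyer.Rank1Residual.Additive.DefectCountFiniteLevel.natCard_quot_adicCompletionIntegers_prime_pow_rat (p := 2)
        (coe_primesEquiv_eq_of_natCast_mem hv') J
    have hA : Nat.card (galoisCohomology ((W₂.torsionGaloisModule ((2 ^ J : ℕ) : ℤ)).toLocal (Sum.inr v)) 1) =
        2 ^ J * 2 ^ J := by
      have h := natCard_galoisCohomology_one_torsion_adicCompletion_eq_sqEP W₂ v (2 ^ J) hnpp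
      rw [hker1, hq, one_mul, sq] at h
      exact h
    have hRS := SelfDualCount.relIndex_kummer_update_bot_update_top_eq W₂ (2 ^ J) hnpp inv hperf hvan hcomp hEP hreal v
    rw [hker1, hq, one_mul] at hRS
    have hxle := natCard_selmerGroup_dualTransported_update_le W₂ (2 ^ J) e₂ hμ hadd₁ hadd₂ hgal hnondeg inv hperf hvan hcomp
      hTout hKumUnr hvT L (fun u hu ↦ hKumT u) hA hRS hL
    rw [← h𝓑'eq] at hxle
    set T𝓑' := inv.dualTransported 𝓑' (weilDualIntertwining W₂ (2 ^ J) e₂ hμ hadd₁ hadd₂ hgal) with hT𝓑'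
    -- finiteness of `H¹_{w⁻¹𝓑'^*}` and of `H¹_𝓑`: both structures are Kummer off `Tx`
    haveI hTfin : Finite T𝓑'.selmerGroup := finite_selmerGroup_of_eq_kummer_off W₂ (2 ^ J) Tx T𝓑' fun u hu ↦ by
      have hne : u ≠ Sum.inr v := fun h ↦ hu (h ▸ hvT)
      rw [hT𝓑', ← hKumT u]
      ext y
      simp only [LocalInvariants.mem_dualTransported_iff, LocalInvariants.dualSelmerStructure_apply, h𝓑'eq,
        Function.update_of_ne hne]
    haveI h𝓑fin : Finite 𝓑.selmerGroup := finite_selmerGroup_of_eq_kummer_off W₂ (2 ^ J) Tx 𝓑 fun u hu ↦ by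
      have hne : u ≠ Sum.inr v := fun h ↦ hu (h ▸ hvT)
      rcases u with w | ℓ
      · exact absurd (hinfTx w) hu
      · rw [heqoff ℓ hu, h𝓑'eq, Function.update_of_ne hne]
    have hTB : Nat.card T𝓑'.selmerGroup ≤ B :=
      hxle.trans ((Nat.card_mono (Set.toFinite _) (selmerGroup_mono hle)).trans hB)
    -- (5b) every class of `H¹_{w⁻¹𝓑'^*}` is killed by `2^B`
    have hkill : ∀ x ∈ T𝓑'.selmerGroup, 2 ^ B • x = 0 := by
      intro x hx
      have h1 : addOrderOf (⟨x, hx⟩ : T𝓑'.selmerGroup) ∣ 2 ^ J :=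
        addOrderOf_dvd_iff_nsmul_eq_zero.2 (Subtype.ext (galoisCohomology.nsmul_eq_zero_of_forall _ hMn x))
      obtain ⟨i, -, hi⟩ := (Nat.dvd_prime_pow Nat.prime_two).1 h1
      have h2 : 2 ^ i ≤ B := by
        rw [← hi]; exact (Nat.le_of_dvd Nat.card_pos (addOrderOf_dvd_natCard _)).trans hTB
      have hiB : i ≤ B := ((Nat.lt_pow_self (by norm_num : 1 < 2)).le.trans h2)
      have h3 : addOrderOf (⟨x, hx⟩ : T𝓑'.selmerGroup) ∣ 2 ^ B := by rw [hi]; exact pow_dvd_pow 2 hiB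
      exact congrArg Subtype.val (addOrderOf_dvd_iff_nsmul_eq_zero.1 h3)
    -- (5c) no `Γ_ℚ`-fixed point in `W₂[2^∞]` (`W₂(ℚ_v)[2] = 0`)
    have hΓ : ∀ Q : W₂.geomPrimaryTorsion 2, (∀ σ : absoluteGaloisGroup ℚ, σ • Q = Q) → Q = 0 :=
      geomPrimaryTorsion_eq_zero_of_fixed_of_adicCompletion W₂ 2 v h0v
    -- (5d) `H¹_{w⁻¹𝓑'^*} ≤ H¹_{w⁻¹𝓑^*}`: at the odd places of `Sf` the localisation is a Kummer class, hence ZERO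
    have hTle : T𝓑'.selmerGroup ≤
        (inv.dualTransported 𝓑 (weilDualIntertwining W₂ (2 ^ J) e₂ hμ hadd₁ hadd₂ hgal)).selmerGroup := by
      intro x hx
      have hx' := (SelmerStructure.mem_selmerGroup_iff _ _).1 hx
      refine (SelmerStructure.mem_selmerGroup_iff _ _).2 fun u ↦ ?_
      -- where `𝓑 u = 𝓑' u` the transported dual conditions agree
      have hcongr : 𝓑 u = 𝓑' u → galoisCohomology.localization _ u 1 x ∈
          inv.dualTransported 𝓑 (weilDualIntertwining W₂ (2 ^ J) e₂ hμ hadd₁ hadd₂ hgal) u := fun hu ↦ by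
        have h := hx' u
        rw [hT𝓑'] at h
        simp only [LocalInvariants.mem_dualTransported_iff, LocalInvariants.dualSelmerStructure_apply, hu] at h ⊢
        exact h
      rcases u with w | ℓ
      · exact hcongr (by rw [h𝓑inl w, h𝓑'inl w])
      · by_cases hℓv : ℓ = v
        · exact hcongr (by rw [hℓv, h𝓑v, h𝓑'v])
        · by_cases hℓT : (Sum.inr ℓ : Place ℚ) ∈ Tx
          · -- `ℓ ∈ Sf`, `ℓ ≠ v`: the localisation vanishes
            have hℓS : ℓ ∈ Sf := (hSfmem ℓ).2 hℓT
            have hℓ2 : ((2 : ℕ) : 𝓞 ℚ) ∉ ℓ.asIdeal := fun h ↦ hℓv (eq_of_natCast_mem_asIdeal (p := 2) hv' h)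
            have hlocK : galoisCohomology.localization (W₂.torsionGaloisModule ((2 ^ J : ℕ) : ℤ)) (Sum.inr ℓ) 1 x ∈
                W₂.kummerLocalConditionAt ((2 ^ J : ℕ) : ℤ) (ℓ.adicCompletion ℚ) := by
              have h := hx' (Sum.inr ℓ)
              rw [hT𝓑'] at h
              have hcond : inv.dualTransported 𝓑' (weilDualIntertwining W₂ (2 ^ J) e₂ hμ hadd₁ hadd₂ hgal) (Sum.inr ℓ) =
                  W₂.kummerSelmerStructure ((2 ^ J : ℕ) : ℤ) (Sum.inr ℓ) := by
                rw [← hKumT (Sum.inr ℓ)]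
                ext y
                simp only [LocalInvariants.mem_dualTransported_iff, LocalInvariants.dualSelmerStructure_apply, h𝓑'eq,
                  Function.update_of_ne (show (Sum.inr ℓ : Place ℚ) ≠ Sum.inr v from fun h' ↦ hℓv (Sum.inr_injective h'))]
              rw [hcond] at h
              exact h
            have h0 := localization_eq_zero_of_pow_smul_eq_zero_of_mem_kummer W₂ 2 hΓ ℓ hℓ2 (e ℓ) (he ℓ) (hJe ℓ hℓS)
              x (hkill x hx) hlocK
            rw [h0]
            exact AddSubgroup.zero_mem _
          · exact hcongr (heqoff ℓ hℓT)
    -- (5e) conclude: `H¹_{𝓑'^*} ≤ H¹_{𝓑^*}`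
    have hDle : (inv.dualSelmerStructure (W₂.torsionGaloisModule ((2 ^ J : ℕ) : ℤ)) 𝓑').selmerGroup ≤
        (inv.dualSelmerStructure (W₂.torsionGaloisModule ((2 ^ J : ℕ) : ℤ)) 𝓑).selmerGroup := by
      rw [SelfDualCount.dualSelmerGroup_eq_map_selmerGroup_dualTransported W₂ (2 ^ J) e₂ hμ hadd₁ hadd₂ hgal hnondeg inv 𝓑',
        SelfDualCount.dualSelmerGroup_eq_map_selmerGroup_dualTransported W₂ (2 ^ J) e₂ hμ hadd₁ hadd₂ hgal hnondeg inv 𝓑]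
      exact AddSubgroup.map_mono hTle
    rw [(AddSubgroup.addSubgroupOf_eq_top).2 hDle, ← AddSubgroup.index_eq_card, AddSubgroup.index_top]
  /- (6) assembly -/
  rw [hD, mul_one] at key
  -- `#(H¹_𝓑/H¹_𝓑') · #H¹_𝓑' = #H¹_𝓑`
  have hsel : 𝓑'.selmerGroup ≤ 𝓑.selmerGroup := fun _ hx ↦
    (SelmerStructure.mem_selmerGroup_iff _ _).2 fun u ↦ hle u ((SelmerStructure.mem_selmerGroup_iff _ _).1 hx u)
  have hq : Nat.card 𝓑.selmerGroup =
      Nat.card (𝓑.selmerGroup ⧸ (𝓑'.selmerGroup).addSubgroupOf 𝓑.selmerGroup) * Nat.card 𝓑'.selmerGroup := by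
    rw [AddSubgroup.card_eq_card_quotient_mul_card_addSubgroup ((𝓑'.selmerGroup).addSubgroupOf 𝓑.selmerGroup),
      Nat.card_congr (AddSubgroup.addSubgroupOfEquivOfLe hsel).toEquiv]
  -- the local products
  have hfin : ∀ u : HeightOneSpectrum (𝓞 ℚ), Finite (galoisCohomology ((W₂.torsionGaloisModule ((2 ^ J : ℕ) : ℤ)).toLocal (Sum.inr u)) 1) :=
    fun u ↦ finite_galoisCohomology_toLocal_inr W₂ (2 ^ J) u
  have hpos : 0 < ∏ u ∈ Sf, Nat.card (𝓑' (Sum.inr u)) := Finset.prod_pos fun u _ ↦ by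
    haveI := hfin u; exact Nat.card_pos
  have hprod : ∏ u ∈ Sf, Nat.card (𝓑 (Sum.inr u)) =
      (∏ u ∈ Sf, Nat.card (𝓑' (Sum.inr u))) * ∏ u ∈ Sf, (if u = v then 1 else 2 ^ a u) := by
    rw [← Finset.prod_mul_distrib]
    refine Finset.prod_congr rfl fun u hu ↦ ?_
    by_cases huv : u = v
    · rw [if_pos huv, mul_one, huv, h𝓑v, h𝓑'v]
    · rw [if_neg huv, hloc𝓑 u hu huv]
  have hvSf : v ∈ Sf := (hSfmem v).2 hvT
  have htam : 2 ^ padicValNat 2 W₂.tamagawaProduct = 2 ^ a v * ∏ u ∈ Sf, (if u = v then 1 else 2 ^ a u) := by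
    rw [pow_padicValNat_tamagawaProduct_eq_prod W₂ 2 Sf (fun u hu ↦ (hSfmem u).2 (hbadTx u hu)),
      ← Finset.mul_prod_erase Sf _ hvSf, ← Finset.mul_prod_erase Sf (fun u ↦ if u = v then 1 else 2 ^ a u) hvSf,
      if_pos rfl, one_mul]
    congr 1
    exact Finset.prod_congr rfl fun u hu ↦ by rw [if_neg (Finset.ne_of_mem_erase hu)]
  rw [hprod] at key
  -- `q · P' = P' · F` ⟹ `q = F`
  have hqF : Nat.card (𝓑.selmerGroup ⧸ (𝓑'.selmerGroup).addSubgroupOf 𝓑.selmerGroup) =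
      ∏ u ∈ Sf, (if u = v then 1 else 2 ^ a u) := by
    apply Nat.eq_of_mul_eq_mul_right hpos
    rw [key, mul_comm]
  rw [htam, hq, hqF]
  ring

end FlatBlindTamagawaSplitting

end Summit.BirchSwinnertonDyer.BirchSwinnertonDyer.Theorems

end
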